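import Summits.ResolutionOfSingularities.KangarooAtlas.MizutaniRootTower
import Summits.ResolutionOfSingularities.KangarooAtlas.MizutaniRankBox
import HarnessLib

/-!
# Mizutani's conjecture `m(e) = 2p^e − 1` — the coordinate map `Ω` of a tower and THEOREM F for `K = L(x^{1/q})`

Cell topic `Summits/ResolutionOfSingularities/KangarooAtlas` (pub-rosobs); namespace
`Summit.ResolutionOfSingularities.KangarooAtlas.Mizutani`.  Part of the Lean transcription of the
in-house note MIZUTANI-PROOF-g59 (AI-written, AI-audited; *AI review is weaker than expert review*; not a
resolution theorem).  For a tower `K = L(a)`, `a_i^q = x_i` (`IsRootTower`, §1.1):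

* the ANTI-Hasse–Schmidt operators `sigD T y = coeff_{u^T} (y(a − u))` (coefficients of the anti-Taylor
  morphism `sig`; `sigD 0 = id`, `L`-linear, zero outside the box) — the operator family the profile machinery
  runs on (signs are immaterial for spans);
* the **coordinate map** `Omega : K ⊗_L K → K[X]`, `y ⊗ z ↦` box part of `y · z(a + X)` (so that
  `1 ⊗ a_i ↦ a_i + X_i`, i.e. `X_i` is the coordinate `1 ⊗ a_i − a_i ⊗ 1`; MIZUTANI-PROOF-g59 §1.2 with the
  opposite sign of `t`), `K`-linear for the left structure, landing in the box, with constant coefficient the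
  multiplication map;
* **the intertwining** `Omega ∘ (sigD_T ⊗ 1) = E_T ∘ Omega` for `|T| + 1 ≤ q` (`Omega_map`), proved with the
  generating functions of `MizutaniSpreadOps`: modulo `(u^q)`, `ℰ(F) = Λ(F)` for the ring map
  `Λ : K[X] → K[X][u]/(u^q)`, `c ↦ c(a − u)`, `X ↦ X + u`, and `Λ(a_i + X_i) = a_i + X_i` — the `u`'s cancel;
* hence a `BoxTowerBridge` and **THEOREM F for towers** (`theoremF_rootTower`): every genuine
  `ω ∈ K ⊗_L K` has tensor rank `≥ 2q`.

References: [Mizutani1973HironakaGroupSchemes] (Remark 2.10; in-house proof §1.2–1.4, §9);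
[Oda1983HironakaGroupSchemeII] §1 (p. 1166); [EGAIV4] Thm. 16.11.2.
-/

open MvPolynomial TensorProduct Literature.AlgebraicGeometry.Resolution

namespace Summit.ResolutionOfSingularities.KangarooAtlas.Mizutani

section Bridge

variable {L K : Type*} [Field L] [Field K] [Algebra L K] {s p e : ℕ} [hp : Fact p.Prime] [CharP K p]
  {x : Fin s → L} {a : Fin s → K}

/-! ### The anti-Hasse–Schmidt operators -/

/-- **The anti-Hasse–Schmidt operator** `sigD T y = coeff_{u^T}` of the box representative of `y(a − u)`.
[cite: EGAIV4, Thm. 16.11.2 (coefficients of a Taylor morphism)] -/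
noncomputable def IsRootTower.sigD (h : IsRootTower L K (p ^ e) x a) (T : Fin s →₀ ℕ) : K →ₗ[L] K where
  toFun y := coeff T (truncQ (Fin s) K (p ^ e) (h.sig y))
  map_add' y z := by rw [map_add, map_add, coeff_add]
  map_smul' l y := by
    simp only [Algebra.smul_def, RingHom.id_apply]
    rw [map_mul, AlgHom.commutes, Ideal.Quotient.alg_map_eq, RingHom.comp_apply,
      MvPolynomial.algebraMap_apply, Ideal.Quotient.algebraMap_eq, truncQ_C_mul, coeff_C_mul]

/-- `sigD T y` unfolded. [folklore] -/
theorem IsRootTower.sigD_apply (h : IsRootTower L K (p ^ e) x a) (T : Fin s →₀ ℕ) (y : K) :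
    h.sigD T y = coeff T (truncQ (Fin s) K (p ^ e) (h.sig y)) := rfl

/-- `sigD 0 = id`. [cite: EGAIV4, Thm. 16.11.2 (D_0 = 1)] -/
theorem IsRootTower.sigD_zero (h : IsRootTower L K (p ^ e) x a) : h.sigD 0 = LinearMap.id := by
  ext y
  rw [h.sigD_apply, LinearMap.id_apply, ← augment_eq_coeff_zero]
  exact (h.augment_tau y).2

/-- `sigD T = 0` outside the box. [folklore] -/
theorem IsRootTower.sigD_eq_zero_of_not_inBox (h : IsRootTower L K (p ^ e) x a) {T : Fin s →₀ ℕ}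
    (hT : ¬ InBox (p ^ e) T) (y : K) : h.sigD T y = 0 := by
  rw [h.sigD_apply]
  by_contra hne
  exact hT (inBox_of_mem_support_truncQ _ (mem_support_iff.mpr hne))

/-- The box representative of `sig y`, expanded in the `sigD T y`. [folklore] -/
theorem IsRootTower.map_truncQ_sig (h : IsRootTower L K (p ^ e) x a) (y : K) :
    MvPolynomial.map (C : K →+* MvPolynomial (Fin s) K) (truncQ (Fin s) K (p ^ e) (h.sig y)) =
      ∑ T ∈ (truncQ (Fin s) K (p ^ e) (h.sig y)).support, monomial T (C (h.sigD T y)) := by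
  conv_lhs => rw [(truncQ (Fin s) K (p ^ e) (h.sig y)).as_sum, map_sum]
  exact Finset.sum_congr rfl fun T _ => by rw [map_monomial]; rfl

/-! ### The coordinate map `Ω` -/

/-- `y ↦ [C y]`, the left factor's embedding into `K[u]/(u^q)`. [folklore] -/
noncomputable def constQ (L K : Type*) [Field L] [Field K] [Algebra L K] (s q : ℕ) :
    K →ₐ[L] BoxQuot (Fin s) K q :=
  (Ideal.Quotient.mkₐ L (boxIdeal (Fin s) K q)).comp (IsScalarTower.toAlgHom L K (MvPolynomial (Fin s) K))

/-- `constQ y = [C y]`. [folklore] -/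
@[simp] theorem constQ_apply (q : ℕ) (y : K) :
    constQ L K s q y = Ideal.Quotient.mk (boxIdeal (Fin s) K q) (C y) := rfl

/-- `Ω̃ : y ⊗ z ↦ [C y] · z(a + u)` as an `L`-algebra map `K ⊗_L K → K[u]/(u^q)`.
[cite: Oda1983HironakaGroupSchemeII, §1 (p. 1166: R = k ⊗_L k ≅ k[t]/(t^q))] -/
noncomputable def IsRootTower.omegaTilde (h : IsRootTower L K (p ^ e) x a) :
    K ⊗[L] K →ₐ[L] BoxQuot (Fin s) K (p ^ e) :=
  Algebra.TensorProduct.productMap (constQ L K s (p ^ e)) h.tau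

/-- `Ω̃ (y ⊗ z) = [C y] · tau z`. [folklore] -/
theorem IsRootTower.omegaTilde_tmul (h : IsRootTower L K (p ^ e) x a) (y z : K) :
    h.omegaTilde (y ⊗ₜ z) = Ideal.Quotient.mk _ (C y) * h.tau z := by
  unfold IsRootTower.omegaTilde
  rw [Algebra.TensorProduct.productMap_apply_tmul, constQ_apply]

/-- `Ω̃` is `K`-semilinear for the left structure. [folklore] -/
theorem IsRootTower.omegaTilde_smul (h : IsRootTower L K (p ^ e) x a) (c : K) (ω : K ⊗[L] K) :
    h.omegaTilde (c • ω) = Ideal.Quotient.mk _ (C c) * h.omegaTilde ω := by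
  induction ω using TensorProduct.induction_on with
  | zero => rw [smul_zero, map_zero, mul_zero]
  | tmul y z =>
    rw [TensorProduct.smul_tmul', smul_eq_mul, h.omegaTilde_tmul, h.omegaTilde_tmul, map_mul, map_mul,
      mul_assoc]
  | add ω₁ ω₂ h₁ h₂ => rw [smul_add, map_add, map_add, h₁, h₂, mul_add]

/-- **The coordinate map** `Ω : K ⊗_L K → K[X]` (box part of `Ω̃`), `K`-linear for the left structure
(MIZUTANI-PROOF-g59 §1.2: left coefficients in the basis `t^M`, here with `X_i = 1 ⊗ a_i − a_i ⊗ 1`).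
[cite: Oda1983HironakaGroupSchemeII, §1 (p. 1166)] -/
noncomputable def IsRootTower.Omega (h : IsRootTower L K (p ^ e) x a) :
    K ⊗[L] K →ₗ[K] MvPolynomial (Fin s) K where
  toFun ω := truncQ (Fin s) K (p ^ e) (h.omegaTilde ω)
  map_add' ω₁ ω₂ := by rw [map_add, map_add]
  map_smul' c ω := by rw [h.omegaTilde_smul, truncQ_C_mul, RingHom.id_apply, C_mul']

/-- `Ω (y ⊗ z) = C y · (box part of tau z)`. [folklore] -/
theorem IsRootTower.Omega_tmul (h : IsRootTower L K (p ^ e) x a) (y z : K) :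
    h.Omega (y ⊗ₜ z) = C y * truncQ (Fin s) K (p ^ e) (h.tau z) := by
  show truncQ (Fin s) K (p ^ e) (h.omegaTilde (y ⊗ₜ z)) = _
  rw [h.omegaTilde_tmul, truncQ_C_mul]

/-- `Ω` lands in the box. [folklore] -/
theorem IsRootTower.Omega_box (h : IsRootTower L K (p ^ e) x a) (ω : K ⊗[L] K) :
    ∀ M ∈ (h.Omega ω).support, InBox (p ^ e) M := fun _ hM => inBox_of_mem_support_truncQ _ hM

/-- **The constant coefficient of `Ω` is the multiplication map** (`μ = ev₀ ∘ Ω`, MIZUTANI-PROOF-g59 §1.2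
`J = ker μ`). [cite: Oda1983HironakaGroupSchemeII, §1 (p. 1166)] -/
theorem IsRootTower.Omega_coeff_zero (h : IsRootTower L K (p ^ e) x a) (ω : K ⊗[L] K) :
    coeff 0 (h.Omega ω) = Algebra.TensorProduct.lmul'' L (S := K) ω := by
  have hq : 1 ≤ p ^ e := Nat.one_le_pow _ _ hp.out.pos
  show coeff 0 (truncQ (Fin s) K (p ^ e) (h.omegaTilde ω)) = _
  rw [← augment_eq_coeff_zero hq]
  induction ω using TensorProduct.induction_on with
  | zero => rw [map_zero, map_zero, map_zero]
  | tmul y z =>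
    rw [h.omegaTilde_tmul, map_mul, (h.augment_tau z).1]
    show augment s K (p ^ e) hq (Ideal.Quotient.mk _ (C y)) * z = y * z
    congr 1
    unfold augment
    rw [Ideal.Quotient.liftₐ_apply, Ideal.Quotient.lift_mk]
    exact aeval_C _ y
  | add ω₁ ω₂ h₁ h₂ => rw [map_add, map_add, h₁, h₂, map_add]

/-! ### The generating-function computation modulo `(u^q)` -/

/-- `K[u]/(u^q) → K[X][u]/(u^q)` induced by the inclusion of constants `K → K[X]`. [folklore] -/
noncomputable def mapQ (K : Type*) [Field K] (s q : ℕ) :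
    BoxQuot (Fin s) K q →+* BoxQuot (Fin s) (MvPolynomial (Fin s) K) q :=
  Ideal.quotientMap _ (MvPolynomial.map (C : K →+* MvPolynomial (Fin s) K)) (by
    intro f hf
    rw [Ideal.mem_comap, mem_boxIdeal_iff]
    rw [mem_boxIdeal_iff] at hf
    exact fun M hM => hf M (support_map_subset _ _ hM))

/-- `mapQ [f] = [map C f]`. [folklore] -/
@[simp] theorem mapQ_mk {q : ℕ} (f : MvPolynomial (Fin s) K) :
    mapQ K s q (Ideal.Quotient.mk _ f) = Ideal.Quotient.mk _ (MvPolynomial.map C f) := by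
  unfold mapQ; rw [Ideal.quotientMap_mk]

/-- The generating function `𝒟_n` of the anti-Hasse–Schmidt operators is the box representative of `sig`,
once `n` exceeds every box degree. [cite: EGAIV4, Thm. 16.11.2] -/
theorem IsRootTower.Dhat_sigD (h : IsRootTower L K (p ^ e) x a) {n : ℕ}
    (hn : ∀ T : Fin s →₀ ℕ, InBox (p ^ e) T → T.degree ≤ n) (w : K) :
    Dhat (fun T => (h.sigD T).toAddMonoidHom) n w =
      MvPolynomial.map (C : K →+* MvPolynomial (Fin s) K) (truncQ (Fin s) K (p ^ e) (h.sig w)) := by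
  refine MvPolynomial.ext _ _ fun T => ?_
  rw [coeff_Dhat, coeff_map]
  show (if T.degree ≤ n then C (h.sigD T w) else 0) = C (coeff T (truncQ (Fin s) K (p ^ e) (h.sig w)))
  rw [← h.sigD_apply]
  split_ifs with hT
  · rfl
  · rw [h.sigD_eq_zero_of_not_inBox (fun hbox => hT (hn T hbox)), C_0]

/-- The ring map `Λ : K[X] → K[X][u]/(u^q)`, `c ↦ c(a − u)` on constants, `X ↦ X + u`. [folklore] -/
noncomputable def IsRootTower.lam (h : IsRootTower L K (p ^ e) x a) :
    MvPolynomial (Fin s) K →+* BoxQuot (Fin s) (MvPolynomial (Fin s) K) (p ^ e) :=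
  eval₂Hom ((mapQ K s (p ^ e)).comp h.sig.toRingHom) fun i => Ideal.Quotient.mk _ (C (X i) + X i)

/-- **`[ℰ_n(F)] = Λ(F)`** in `K[X][u]/(u^q)`: the generating function of the profile operators of the tower is,
modulo `u^q`, a RING MAP. [cite: EGAIV4, Thm. 16.11.2 (the Taylor morphism is a ring map)] -/
theorem IsRootTower.mk_Ehat (h : IsRootTower L K (p ^ e) x a) {n : ℕ}
    (hn : ∀ T : Fin s →₀ ℕ, InBox (p ^ e) T → T.degree ≤ n) (F : MvPolynomial (Fin s) K) :
    Ideal.Quotient.mk _ (Ehat (fun T => (h.sigD T).toAddMonoidHom) n F) = h.lam F := by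
  unfold Ehat
  conv_rhs => rw [F.as_sum]
  rw [map_sum, map_sum]
  refine Finset.sum_congr rfl fun M _ => ?_
  rw [map_mul, h.Dhat_sigD hn, ← mapQ_mk, mk_truncQ]
  unfold IsRootTower.lam
  rw [coe_eval₂Hom, eval₂_monomial, RingHom.comp_apply]
  congr 1
  unfold taylor
  rw [aeval_monomial, map_one, one_mul, map_finsuppProd]
  refine Finset.prod_congr rfl fun i _ => ?_
  exact map_pow _ _ _

/-- The box monomials `(a + X)^W = ∏ (a_i + X_i)^{W_i}` of `Ω`. [folklore] -/
noncomputable def pPlus (a : Fin s → K) (W : Fin s →₀ ℕ) : MvPolynomial (Fin s) K :=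
  ∏ i, (C (a i) + X i) ^ W i

/-- `Λ((a + X)^W) = [(a + X)^W]`: the `u`'s cancel. [folklore] -/
theorem IsRootTower.lam_pPlus (h : IsRootTower L K (p ^ e) x a) (W : Fin s →₀ ℕ) :
    h.lam (pPlus a W) = Ideal.Quotient.mk _ (C (pPlus a W)) := by
  unfold pPlus IsRootTower.lam
  rw [map_prod, map_prod, map_prod]
  refine Finset.prod_congr rfl fun i _ => ?_
  rw [map_pow, map_pow, map_pow, map_add, eval₂Hom_C, eval₂Hom_X', RingHom.comp_apply, AlgHom.toRingHom_eq_coe,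
    RingHom.coe_coe, h.sig_gen, mapQ_mk, map_sub, map_C, map_X, ← map_add]
  congr 2
  rw [map_add]
  ring

/-- `tau (a^W) = [(a + X)^W]`. [folklore] -/
theorem IsRootTower.tau_prod_pow (h : IsRootTower L K (p ^ e) x a) (W : Fin s →₀ ℕ) :
    h.tau (∏ i, a i ^ W i) = Ideal.Quotient.mk _ (pPlus a W) := by
  unfold pPlus
  rw [map_prod, map_prod]
  exact Finset.prod_congr rfl fun i _ => by rw [map_pow, map_pow, h.tau_gen]

/-- `(a + X)^W` only involves monomials `X^V` with `V ≤ W`; in particular it lies in the box when `W` does.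
[folklore] -/
theorem inBox_of_mem_support_pPlus {q : ℕ} {W : Fin s →₀ ℕ} (hW : InBox q W) {V : Fin s →₀ ℕ}
    (hV : V ∈ (pPlus a W).support) : InBox q V := by
  have key : pPlus a W = MvPolynomial.map (eval a) (taylor K (monomial W (1 : K))) := by
    unfold pPlus
    rw [monomial_eq, C_1, one_mul, map_finsuppProd, map_finsuppProd, Finsupp.prod_fintype _ _ (fun i => by simp)]
    refine Finset.prod_congr rfl fun i _ => ?_
    rw [map_pow, map_pow, taylor_X, map_add, map_C, map_X, eval_X]
  rw [key, mem_support_iff, coeff_map, ← hasseDeriv_apply] at hV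
  have hle : V ≤ W := by
    by_contra hnot
    exact hV (by rw [hasseDeriv_monomial_eq_zero_of_not_le K hnot, map_zero])
  exact fun i => lt_of_le_of_lt (hle i) (hW i)

/-- **The core identity**: `E_T (y · (a+X)^W) = (sigD_T y) · (a+X)^W` for `T` in the box (any `W`).
[cite: Mizutani1973HironakaGroupSchemes, Remark 2.10 (in-house proof §1.4 MONOMIALS / Leibniz)] -/
theorem IsRootTower.opE_C_mul_pPlus (h : IsRootTower L K (p ^ e) x a) {T : Fin s →₀ ℕ} (W : Fin s →₀ ℕ)
    (hT : InBox (p ^ e) T) (y : K) :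
    opE (fun T => (h.sigD T).toAddMonoidHom) T (C y * pPlus a W) = C (h.sigD T y) * pPlus a W := by
  classical
  -- degree bound for the box
  set n := ∑ _i : Fin s, p ^ e with hn
  have hbox : ∀ T' : Fin s →₀ ℕ, InBox (p ^ e) T' → T'.degree ≤ n := fun T' hT' => by
    rw [Finsupp.degree_eq_sum]
    exact Finset.sum_le_sum fun i _ => (hT' i).le
  rw [← coeff_Ehat (fun T => (h.sigD T).toAddMonoidHom) (n := n) _ (hbox T hT)]
  -- the box-supported comparison polynomial `Θ̂`
  set Θ : Big (Fin s) K := ∑ T' ∈ (truncQ (Fin s) K (p ^ e) (h.sig y)).support,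
    monomial T' (C (h.sigD T' y) * pPlus a W) with hΘ
  have hdiff : Ehat (fun T => (h.sigD T).toAddMonoidHom) n (C y * pPlus a W) - Θ ∈
      boxIdeal (Fin s) (MvPolynomial (Fin s) K) (p ^ e) := by
    rw [← Ideal.Quotient.eq, h.mk_Ehat hbox, map_mul, h.lam_pPlus]
    unfold IsRootTower.lam
    rw [eval₂Hom_C, RingHom.comp_apply, AlgHom.toRingHom_eq_coe, RingHom.coe_coe, ← mk_truncQ (h.sig y),
      mapQ_mk, ← map_mul, h.map_truncQ_sig, Finset.sum_mul]
    congr 1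
    refine Finset.sum_congr rfl fun T' _ => ?_
    rw [mul_comm, C_mul_monomial, mul_comm]
  have hcoeff : coeff T (Ehat (fun T => (h.sigD T).toAddMonoidHom) n (C y * pPlus a W)) = coeff T Θ := by
    rw [mem_boxIdeal_iff] at hdiff
    by_contra hne
    have hmem : T ∈ (Ehat (fun T => (h.sigD T).toAddMonoidHom) n (C y * pPlus a W) - Θ).support := by
      rw [mem_support_iff, coeff_sub]; exact sub_ne_zero.mpr hne
    exact hdiff T hmem hT
  rw [hcoeff, hΘ, coeff_sum]
  simp only [coeff_monomial]
  rw [Finset.sum_ite_eq']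
  split_ifs with hmem
  · rfl
  · rw [h.sigD_apply, notMem_support_iff.mp hmem, C_0, zero_mul]

end Bridge

end Summit.ResolutionOfSingularities.KangarooAtlas.Mizutani
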